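import Literature.NumberTheory.LFunctions.OneLevelDensityExtremalSOEven

/-!
# Route `PrimeLevelFamEdge` — TYPED IDEA DELTAS, deck 10: the DENSITY DOOR'S DUAL objects
# (cell ls-idea, seat ls-idea-lens-15, LENSES-v3 `dual`; cards K-L15-1 «THE DENSITY DOOR'S EXACT DUAL»,
# K-L15-2 «THE (A)-WORLD DENSITY PLATEAU»)

PROOF-FREE PARAMETRIC `Prop`s + one-line glue over the Literature vocabulary
`OneDeltaSOEven.{mass, soEvenQuad, alphaSOEven, SOEvenFloor, IsDoorThreshold}` and the NAMED FACT
`carneiroChirreMilinovich2022_oneDelta_soEven` (`Literature/NumberTheory/LFunctions/OneLevelDensityExtremalSOEven.lean`).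
Typed from the seat's `Sketch_DensityDual.lean` (sha16 d6109a3dc8bc268f, statements only, rc 0), the
0-ary target laws made PARAMETRIC (typer rule: a 0-ary cited `Prop` in a Summits deck is relocated by the
gate). Both cards are INSTRUMENT/LAW grade by construction (no door, no crux toward S; D2 value = TIE):
K-L15-1 — certified NO-GO on the test-function axis below `v* = 1.69101506988…` for the whole admissible
class; K-L15-2 — in the (A)-world functional of record `D⁺_A = SO(even) + ∫_{1+2d}^{v} g` (BN-16 (R3)) a
Schur dual witness certifies the door SHUT for every test function of support `v ≤ 2 − 2d`. NOTHING here
is asserted or proved about `L`-functions; «no exceptional-zero theorem (no Landau–Siegel / Siegel-zero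
exclusion, no Theorem 1–2 of arXiv:2211.02515, no repaired Margin232) is proved by ideation; typed ≠ proved;
computed ≠ proved».
-/

noncomputable section

namespace Summit.Parity.GeneralizedHardyLittlewood.Theorems.PrimeLevelFamEdgeIdeaDeltas

open Literature.NumberTheory.LFunctions Literature.NumberTheory.LFunctions.OneDeltaSOEven
open MeasureTheory Set

/-- **The (A)-world compatible-level quadratic form** (K-L15-2; record BN-16 (R3):
`D⁺_A(g) = SO(even)(g) + ∫_{1+2d}^{v} g`, `d = log D/log N`): the SO(even) form plus
`½ ∬_{|x−y| ≥ 1+2d} h(x) h(y)` on `[−v/2, v/2]²`. A DEFINITION (the card's recipe-grade functional; NOT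
asserted to be the true (A)-world density). [cite: IwaniecLuoSarnak2000, Appendix A (195)] -/
def aWorldQuad (v d : ℝ) (h : ℝ → ℝ) : ℝ :=
  soEvenQuad v h +
    (1 / 2) * ∫ x in (-(v / 2))..(v / 2), ∫ y in (-(v / 2))..(v / 2),
      (if 1 + 2 * d ≤ |x - y| then h x * h y else 0)

/-- **K-L15-1 TARGET LAW 2 «door shut below the threshold»**, PARAMETRIC in the threshold `vs`: for every
support `0 < v ≤ vs` the SO(even) functional is `≥ φ(0)` for EVERY admissible test function
(`SOEvenFloor v 1`) — no test function of support `≤ vs` opens the K-L7-2 atom door. The card's claim is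
`IsDoorThreshold vs → DoorShutBelow vs` (monotonicity of `α` on `(1, 2]` + the floor law + the trivial
range `v ≤ 1`); NOT asserted here. [cite: CarneiroChirreMilinovich2022, Thm 2 (i) and Cor. 8 (ii)] -/
def DoorShutBelow (vs : ℝ) : Prop :=
  ∀ v : ℝ, 0 < v → v ≤ vs → SOEvenFloor v 1

/-- **K-L15-2 TARGET LAW 3 «(A)-world density plateau»**, PARAMETRIC in `d = log D/log N > 0`: for every
support `0 < v ≤ 2 − 2d` and every continuous profile, `mass² ≤ aWorldQuad` (the (A)-functional is `≥ φ(0)`;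
Schur dual witness `‖K_d‖ ≤ d`, first-order tight: `v*_A(d) = 2 − 2d + (4+o(1))d²`). The seat's pencil law;
NOT asserted here. [cite: IwaniecLuoSarnak2000, Appendix A, Prop. A.1 (dual-certificate shape)] -/
def AWorldShutAt (d : ℝ) : Prop :=
  ∀ v : ℝ, 0 < v → v ≤ 2 - 2 * d →
    ∀ h : ℝ → ℝ, ContinuousOn h (Icc (-(v / 2)) (v / 2)) → mass v h ^ 2 ≤ aWorldQuad v d h

/-- Glue (proved, one line): under the printed floor law, at any support `1 < v ≤ 2` where the floor
constant is `≥ 1` the SO(even) functional is `≥ φ(0)` for every admissible test function — the door is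
shut there. (The card's threshold statement adds only «`α(v) ≥ 1 ⟺ v ≤ v*`».)
[cite: CarneiroChirreMilinovich2022, Thm 2 (i) and Cor. 8 (ii)] -/
theorem soEvenFloor_one_of_alpha_ge_one (hF : carneiroChirreMilinovich2022_oneDelta_soEven) {v : ℝ}
    (hv1 : 1 < v) (hv2 : v ≤ 2) (hα : 1 ≤ alphaSOEven v) : SOEvenFloor v 1 :=
  (hF v hv1 hv2).1.anti hα

/-- Bookkeeping (proved, definitional): `DoorShutBelow` is antitone in the threshold.
[cite: CarneiroChirreMilinovich2022, Thm 2 (i)] -/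
theorem DoorShutBelow.anti {vs vs' : ℝ} (h : vs' ≤ vs) (hD : DoorShutBelow vs) : DoorShutBelow vs' :=
  fun v hv0 hv ↦ hD v hv0 (hv.trans h)

/-- Bookkeeping (proved, definitional): the (A)-world form dominates the SO(even) form's floor statement —
if `SOEvenFloor v 1` holds and the extra (A)-term is non-negative for a profile, then `mass² ≤ aWorldQuad`
for that profile. [cite: IwaniecLuoSarnak2000, Appendix A (195)] -/
theorem mass_sq_le_aWorldQuad_of_floor {v d : ℝ} (hfloor : SOEvenFloor v 1) {h : ℝ → ℝ}
    (hh : ContinuousOn h (Icc (-(v / 2)) (v / 2)))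
    (hextra : 0 ≤ ∫ x in (-(v / 2))..(v / 2), ∫ y in (-(v / 2))..(v / 2),
      (if 1 + 2 * d ≤ |x - y| then h x * h y else 0)) :
    mass v h ^ 2 ≤ aWorldQuad v d h := by
  have h1 := hfloor h hh
  rw [one_mul] at h1
  unfold aWorldQuad
  linarith

/-! ## §2 K-L15-2 v1.1 ADDENDUM — BORN-SERIES CERTIFICATES (seat ls-idea-lens-15, sketch v2 sha16
f5f7da064cdd7687; critics A b73 (p) answered / B #34 remarks applied / C b74 / D b2: all PASS), PARAMETRIC
in `d`; + the threshold equation's EXISTENCE AND UNIQUENESS proved (referee B remark 1: «`IsDoorThreshold`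
pins one `vs`»; critic A b73: `g′ ≥ ¼ − 8/81 > 0`). -/

/-- **Born sums of the corona kernel** (K-L15-2 v1.1): `bornS v d = S₀ + S₁ + S₂` with `S₀ = v`,
`S₁ = ⟨K_d 1, 1⟩ = 2d(v−1−d)`, `S₂ = ‖K_d 1‖² = 2d²(v−1−2d) + (4/3)d³` (valid for `1 + 2d ≤ v < 2`).
A DEFINITION (the seat's closed forms; their derivation is pencil/numerics, not typed).
[cite: IwaniecLuoSarnak2000, Appendix A (195) (the kernel being expanded)] -/
def bornS (v d : ℝ) : ℝ :=
  v + 2 * d * (v - 1 - d) + (2 * d ^ 2 * (v - 1 - 2 * d) + 4 / 3 * d ^ 3)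

/-- **K-L15-2 LAW 4 «certified SHUT region» at `d`** (sharper than Schur's `2 − 2d`): for
`1 + 2d ≤ v` with `v(1+d) ≤ 2 + 2d² + (2/3)d³` (`= 2 − 2d + 4d² − (10/3)d³ + O(d⁴)`; `1.806713` at
`d = 1/8`) the (A)-functional is `≥ φ(0)` for every continuous profile. The seat's law (positivity of `K_d`
+ Schur tail); NOT asserted here. PARAMETRIC in `d`. [cite: IwaniecLuoSarnak2000, Appendix A, Prop. A.1 (dual-certificate shape)] -/
def BornShutAt (d : ℝ) : Prop :=
  ∀ v : ℝ, 1 + 2 * d ≤ v → v * (1 + d) ≤ 2 + 2 * d ^ 2 + 2 / 3 * d ^ 3 →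
    ∀ h : ℝ → ℝ, ContinuousOn h (Icc (-(v / 2)) (v / 2)) → mass v h ^ 2 ≤ aWorldQuad v d h

/-- **K-L15-2 LAW 5 «certified OPEN region with an explicit magic vector» at `d`**: for
`1 + 2d ≤ v < 2` with `bornS v d > 2` (i.e. `v > (2 + 2d + 4d² + (8/3)d³)/(1 + 2d + 2d²)`; `1.808943` at
`d = 1/8`, below Fejér's `1.810660`) some continuous profile (the seat's `h₃ = (I + K_d + K_d²)1`) makes the
(A)-functional `< φ(0)`. The seat's law; NOT asserted here. PARAMETRIC in `d`.
[cite: IwaniecLuoSarnak2000, Appendix A (205) (magic-vector shape)] -/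
def BornOpenAt (d : ℝ) : Prop :=
  ∀ v : ℝ, 1 + 2 * d ≤ v → v < 2 → 2 < bornS v d →
    ∃ h : ℝ → ℝ, ContinuousOn h (Icc (-(v / 2)) (v / 2)) ∧ aWorldQuad v d h < mass v h ^ 2

/-- Bookkeeping (proved): a certified shut region at `d` refines `AWorldShutAt d` nowhere it does not
apply — recorded only as the trivial implication «shut for all `v ≤ 2 − 2d`» ⇒ «shut on the Born window
when that window lies below `2 − 2d`». [cite: IwaniecLuoSarnak2000, Appendix A, Prop. A.1] -/
theorem bornShutAt_of_aWorldShutAt {d : ℝ} (hd : 0 < d)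
    (hwin : ∀ v : ℝ, 1 + 2 * d ≤ v → v * (1 + d) ≤ 2 + 2 * d ^ 2 + 2 / 3 * d ^ 3 → v ≤ 2 - 2 * d)
    (h : AWorldShutAt d) : BornShutAt d :=
  fun v hv1 hv2 g hg ↦ h v (by linarith) (hwin v hv1 hv2) g hg

/-- **K-L15-2 LAW 4 «certified SHUT region» at `d`, HARDENED form** (referee B #44 scope remark, 2026-08-28):
the same as `BornShutAt d` with the guard `v < 2` explicit (the Born sums are valid for `1 + 2d ≤ v < 2`, as in
`BornOpenAt`); intended instances `0 < d ≲ 0.34` (BN-16 (R3): `d ≤ ½`). Without the guard, `BornShutAt d` is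
vacuous for `0.342 < d < 1.93` and false-as-typed for `d ≥ 1.93` ((v,h) = (5.05, 1) at `d = 2`, B b82) — hence the
old name is DEPRECATED in favour of this one (append-only protocol: deprecate, don't mutate). The seat's law;
NOT asserted here. [cite: IwaniecLuoSarnak2000, Appendix A, Prop. A.1 (dual-certificate shape)] -/
def BornShutLt2At (d : ℝ) : Prop :=
  ∀ v : ℝ, 1 + 2 * d ≤ v → v < 2 → v * (1 + d) ≤ 2 + 2 * d ^ 2 + 2 / 3 * d ^ 3 →
    ∀ h : ℝ → ℝ, ContinuousOn h (Icc (-(v / 2)) (v / 2)) → mass v h ^ 2 ≤ aWorldQuad v d h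

/-- Bookkeeping (proved): the unguarded shape implies the hardened one. [cite: IwaniecLuoSarnak2000, Appendix A, Prop. A.1] -/
theorem bornShutLt2At_of_bornShutAt {d : ℝ} (h : BornShutAt d) : BornShutLt2At d :=
  fun v hv1 _ hv2 g hg ↦ h v hv1 hv2 g hg

/-- Bookkeeping (proved): `AWorldShutAt d` on the Born window (when it lies below `2 − 2d`) gives the hardened
shut statement. [cite: IwaniecLuoSarnak2000, Appendix A, Prop. A.1] -/
theorem bornShutLt2At_of_aWorldShutAt {d : ℝ} (hd : 0 < d)
    (hwin : ∀ v : ℝ, 1 + 2 * d ≤ v → v * (1 + d) ≤ 2 + 2 * d ^ 2 + 2 / 3 * d ^ 3 → v ≤ 2 - 2 * d)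
    (h : AWorldShutAt d) : BornShutLt2At d :=
  bornShutLt2At_of_bornShutAt (bornShutAt_of_aWorldShutAt hd hwin h)

attribute [deprecated BornShutLt2At (since := "2026-08-28")] BornShutAt
attribute [deprecated bornShutLt2At_of_aWorldShutAt (since := "2026-08-28")] bornShutAt_of_aWorldShutAt

/-! ### The door-threshold equation has exactly one root (proved) -/

/-- `tan y − tan x ≥ y − x` for `0 ≤ x ≤ y < π/2` (mean value theorem, `tan′ = 1/cos² ≥ 1`). [folklore] -/
private theorem sub_le_tan_sub_tan {x y : ℝ} (hx : 0 ≤ x) (hxy : x ≤ y) (hy : y < Real.pi / 2) :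
    y - x ≤ Real.tan y - Real.tan x := by
  rcases eq_or_lt_of_le hxy with heq | hlt
  · rw [heq, sub_self, sub_self]
  have hcos : ∀ z ∈ Icc x y, Real.cos z ≠ 0 := by
    intro z hz
    have h1 : -(Real.pi / 2) < z := by linarith [hz.1, Real.pi_pos]
    have h2 : z < Real.pi / 2 := lt_of_le_of_lt hz.2 hy
    exact (Real.cos_pos_of_mem_Ioo ⟨h1, h2⟩).ne'
  have hcont : ContinuousOn Real.tan (Icc x y) :=
    Real.continuousOn_tan.mono fun z hz ↦ hcos z hz
  have hdiff : ∀ z ∈ Ioo x y, HasDerivAt Real.tan (1 / Real.cos z ^ 2) z :=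
    fun z hz ↦ Real.hasDerivAt_tan (hcos z ⟨hz.1.le, hz.2.le⟩)
  obtain ⟨c, hc, hslope⟩ := exists_hasDerivAt_eq_slope Real.tan (fun z ↦ 1 / Real.cos z ^ 2)
    hlt hcont hdiff
  have hc1 : 1 ≤ 1 / Real.cos c ^ 2 := by
    rw [le_div_iff₀ (by
      have := hcos c ⟨hc.1.le, hc.2.le⟩
      positivity)]
    have := Real.cos_sq_le_one c
    linarith
  rw [hslope, le_div_iff₀ (by linarith)] at hc1
  linarith

/-- **`∃! v*, IsDoorThreshold v*`** (referee B remark 1 / critic A b73, PROVED): `g(v) = tan((v−1)/4) −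
v/(v+8)` is continuous on `[1,2]` with `g(1) = −1/9 < 0 < tan ¼ − 1/5 = g(2)` (`tan ¼ > ¼`) — existence by
the intermediate value theorem — and `g` is strictly increasing there (`tan` grows at rate `≥ ¼·(Δv)/…`:
`tan y − tan x ≥ y − x`, while `v/(v+8)` grows at rate `≤ 8/81 < ¼`) — uniqueness.
[cite: CarneiroChirreMilinovich2022, Cor. 8 (ii) (the equation K(0,0) = 1 solved for Δ)] -/
theorem doorThreshold_existsUnique : ∃! vs : ℝ, IsDoorThreshold vs := by
  -- the function and its values at the endpoints
  have hpi : (1 : ℝ) / 4 < Real.pi / 2 := by linarith [Real.pi_gt_three]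
  have hcont : ContinuousOn (fun v : ℝ ↦ Real.tan ((v - 1) / 4) - v / (v + 8)) (Icc 1 2) := by
    apply ContinuousOn.sub
    · refine Real.continuousOn_tan.comp ((continuous_sub_right 1).div_const 4).continuousOn ?_
      intro v hv
      have h1 : 0 ≤ (v - 1) / 4 := by linarith [hv.1]
      have h2 : (v - 1) / 4 < Real.pi / 2 := by linarith [hv.2, Real.pi_gt_three]
      exact (Real.cos_pos_of_mem_Ioo ⟨by linarith [Real.pi_pos], h2⟩).ne'
    · apply ContinuousOn.div continuousOn_id (continuousOn_id.add continuousOn_const)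
      intro v hv h0
      have h1 := hv.1
      change v + 8 = 0 at h0
      linarith
  have hg1 : Real.tan (((1 : ℝ) - 1) / 4) - 1 / (1 + 8) < 0 := by norm_num
  have hg2 : 0 < Real.tan (((2 : ℝ) - 1) / 4) - 2 / (2 + 8) := by
    have : (1 : ℝ) / 4 < Real.tan (1 / 4) := Real.lt_tan (by norm_num) hpi
    norm_num at this ⊢
    linarith
  -- existence (IVT)
  have h12 : (1 : ℝ) ≤ 2 := by norm_num
  obtain ⟨vs, hvs, hg⟩ : ∃ vs ∈ Icc (1 : ℝ) 2,
      Real.tan ((vs - 1) / 4) - vs / (vs + 8) = 0 := by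
    have hmem : (0 : ℝ) ∈ Icc (Real.tan (((1 : ℝ) - 1) / 4) - 1 / (1 + 8))
        (Real.tan (((2 : ℝ) - 1) / 4) - 2 / (2 + 8)) := ⟨hg1.le, hg2.le⟩
    exact intermediate_value_Icc h12 hcont hmem
  have hvs1 : 1 < vs := by
    rcases eq_or_lt_of_le hvs.1 with h | h
    · exfalso; rw [← h] at hg; linarith
    · exact h
  have hvs2 : vs < 2 := by
    rcases eq_or_lt_of_le hvs.2 with h | h
    · exfalso; rw [h] at hg; linarith
    · exact h
  have hroot : Real.tan ((vs - 1) / 4) = vs / (vs + 8) := by linarith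
  refine ⟨vs, ⟨hvs1, hvs2, hroot⟩, ?_⟩
  -- uniqueness (strict monotonicity)
  rintro w ⟨hw1, hw2, hw⟩
  by_contra hne
  -- order the two roots
  have key : ∀ a b : ℝ, 1 < a → a < b → b < 2 →
      Real.tan ((a - 1) / 4) = a / (a + 8) → Real.tan ((b - 1) / 4) = b / (b + 8) → False := by
    intro a b ha hab hb hta htb
    have htan : (b - 1) / 4 - (a - 1) / 4 ≤ Real.tan ((b - 1) / 4) - Real.tan ((a - 1) / 4) :=
      sub_le_tan_sub_tan (by linarith) (by linarith) (by linarith [Real.pi_gt_three])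
    have hb8 : b + 8 ≠ 0 := by linarith
    have ha8 : a + 8 ≠ 0 := by linarith
    have hfrac : b / (b + 8) - a / (a + 8) = 8 * (b - a) / ((a + 8) * (b + 8)) := by
      rw [div_sub_div _ _ hb8 ha8, div_eq_div_iff (mul_ne_zero hb8 ha8) (mul_ne_zero ha8 hb8)]
      ring
    have hfrac_le : b / (b + 8) - a / (a + 8) ≤ 8 * (b - a) / 81 := by
      rw [hfrac]
      apply div_le_div_of_nonneg_left (by linarith) (by norm_num) (by nlinarith)
    rw [hta, htb] at htan
    have : (b - a) / 4 ≤ 8 * (b - a) / 81 := by linarith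
    have hba : 0 < b - a := by linarith
    rw [div_le_div_iff₀ (by norm_num) (by norm_num)] at this
    nlinarith
  rcases lt_or_gt_of_ne hne with hlt | hgt
  · exact key w vs hw1 hlt hvs2 hw hroot
  · exact key vs w hvs1 hgt hw2 hroot hw

end Summit.Parity.GeneralizedHardyLittlewood.Theorems.PrimeLevelFamEdgeIdeaDeltas
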